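/-
COR-CM (cells pub-hodgecm / pub-hodgecm2, stage 2 of the Hodge ladder) — TRANSPOSITION, item (vi) sub-binder S2, PINNING RECORD, REACH
HALF: TEAM hComp row A1w (`HOME/pinning/HCOMP-TABLE.md` v1.1).  Seat prover-pub-hodgecm2-hcomp-abcm-1-0 (hcomp-abcm-1); path under the
pub-hodgecm2 lead's blanket pre-ACK for `Transposition/HComp/<Name>.lean` (INBOX l.4797 (1), table row A1w, one writer).  THEOREMS
ONLY: no definition, no instance, no named fact, no `variable`, no proof holes.  Nothing in the tree is edited or restated; pin-1's
`Transposition/Item6PinReachAlong.lean` is NOT imported (its binder `hAlb` is re-typed here token for token, so this file is no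
olean hostage of the pin lineage).  FRAMING: HC_CM is NOT proved; `hAlb` becomes a CITED CONDITIONAL on the named fact
`Liu2021.albanese_baseChange_isLimit_fan_jacobian`, not a kernel discharge; `hComp` is NOT discharged by this file.
-/
import Summits.HodgeConjecture.CorCM.CM.Basic
import Literature.NumberTheory.Automorphic.Liu2021.AlbaneseBaseChange
import HarnessLib

/-!
# Item (vi) S2, binder `hAlb` of the pinned REACH junction, from [Liu2021 §2.1] as a cited fact

pin-1's `Model.hComp_of_unif_of_alb_along` (`Transposition/Item6PinReachAlong.lean`) splits the READING binder `hComp` of the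
pinned END display into `hUnif` (Shimura side) and `hAlb`:

  `hAlb` — for every admissible face `(F, Φ, ι₁ ∈ Φ, V)`, every pin embedding `e F ι₁ : F →+* ℂ`, every sufficiently small
  level `K'` of the Appendix-C carrier `C F ι₁ V Φ : AppendixC.Sec42Data …` ([Liu2021] §4.2: `X_{K'} = S̃h(𝕍)_{K'}`,
  `A_{K'} = Alb_{X_{K'}}`), and every finite coproduct decomposition of `X_{K'} ⊗_{E, e ι₁} ℂ` into smooth projective
  geometrically irreducible surfaces `X c`, there are Albanese data `𝒥 c : Jacobian (X c)` and projections exhibiting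
  `A_{K'} ⊗_{E, e ι₁} ℂ` as `∏_c (𝒥 c).J`.

This file proves it — VERBATIM, for EVERY `e` and ALL carriers `P5 iso C` — from the ONE named fact
`Liu2021.albanese_baseChange_isLimit_fan_jacobian` (`Literature/NumberTheory/Automorphic/Liu2021/AlbaneseBaseChange.lean`:
[Liu2021 §2.1 Prop. proof l. 1194–1200 + Lemma 2.2 (1)] with the base-change theorem [AchterCasalainaMartinVial2026 Thm. 3.2
= FGA VI Thm. 3.3 (iii)]), the Albanese data of the complex pieces being the tree's THEOREM
`Motives.nonempty_jacobian_of_isSmoothProjective_complex_of_dim`: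

* `Model.hAlb_holds (hA) (e) (P5) (iso) (C)` — the binder for every `e`;
* `Model.hAlb_holds_conj (hA) (P5) (iso) (C)` — the instance of record, package P2′: `e F ι₁ := (starRingEnd ℂ).comp ι₁`;
* `Model.hAlb_holds_id (hA) (P5) (iso) (C)` — the in-tree instance `e = id` (package P1, binder `hAlb` of
  `Model.hComp_of_unif_of_alb`, `Transposition/Item6PinReachGlue.lean` :183–189).

Instantiation: `k := F`, `σ := e F ι₁`, `X := (C F ι₁ V Φ).X K'` (proper by `CompactifiedSystem.projective_X`, smooth by
`CompactifiedSystem.smooth_X` — §4.2 l. 2064 «smooth projective schemes … of dimension n − 1»), `a := (C F ι₁ V Φ).alb K'`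
(`a.Alb = (C …).A K'` by `rfl`), `n := 2`.  The face guards `IsGalois ℚ F`, `6 ≤ [F:ℚ]`, `ι₁ ∈ Φ.1` are not used.
T5: n/a (one `Prop` binder `hA`).  HC_CM is NOT proved.

References: Y. Liu, arXiv:2102.11518 (`FJcycle.tex` md5 6db49a74122d): §2.1 Proposition l. 1190–1200, Def. 2.3, Lemma 2.2 (1)
l. 1211–1228; §4.2 l. 2060–2066.  J. Achter, S. Casalaina-Martin, Ch. Vial, Ann. Inst. Fourier 76 (2026), Thm. 3.2, Rem. 3.3.
-/

noncomputable section

namespace Summit.HodgeConjecture.CorCM.Model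

open CategoryTheory CategoryTheory.Limits AlgebraicGeometry NumberField
open Literature.AlgebraicGeometry.Motives
open Literature.NumberTheory.Automorphic.Liu2021
open Literature.NumberTheory.Automorphic.Liu2021.AppendixC

/-- **`hAlb` holds, given the named fact `Liu2021.albanese_baseChange_isLimit_fan_jacobian`** — pin-1's binder `hAlb` of
`Model.hComp_of_unif_of_alb_along` (`Transposition/Item6PinReachAlong.lean` :170–177) VERBATIM, for EVERY pin embedding `e`
(P1: `e = id`; P2′ of record: `e F ι₁ = (starRingEnd ℂ).comp ι₁`) and ALL carriers `P5 iso C`: instantiate the fact at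
`k := F`, `σ := e F ι₁`, `X := X_{K'} = (C F ι₁ V Φ).X K'` (proper: `CompactifiedSystem.projective_X`; smooth:
`CompactifiedSystem.smooth_X`, [Liu2021 §4.2 l. 2064]), `a := (C F ι₁ V Φ).alb K'` (so `a.Alb = A_{K'}` by `rfl`,
`Sec42Data.A`), `n := 2`; the Jacobians of the pieces come from the tree theorem
`Motives.nonempty_jacobian_of_isSmoothProjective_complex_of_dim`.  The face guards are not used.  Conditional on the named
fact `hA` only; HC_CM is NOT proved. [cite: Liu2021, §2.1 Proposition (FJcycle.tex l. 1190–1200), Lemma 2.2 (1), §4.2 l. 2060–2066] -/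
theorem hAlb_holds (hA : albanese_baseChange_isLimit_fan_jacobian)
    (e : ∀ (F : CMField), (F →+* ℂ) → (F →+* ℂ))
    (P5 : ∀ (F : CMField) (ι₁ : F →+* ℂ) (_ : HermSpace3 F ι₁) (_ : CMType F), PropC5Data (maximalRealSubfield F) F)
    (iso : ∀ (F : CMField) (ι₁ : F →+* ℂ) (_ : HermSpace3 F ι₁) (_ : CMType F), ℕ → Prop)
    (C : ∀ (F : CMField) (ι₁ : F →+* ℂ) (V : HermSpace3 F ι₁) (Φ : CMType F), Sec42Data (P5 F ι₁ V Φ) (iso F ι₁ V Φ)) :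
    ∀ (F : CMField), IsGalois ℚ F → 6 ≤ Module.finrank ℚ F → ∀ (Φ : CMType F) (ι₁ : F →+* ℂ), ι₁ ∈ Φ.1 →
      ∀ (V : HermSpace3 F ι₁) (K' : C5.SmallLevel (C F ι₁ V Φ).S.K₀) (Cset : Type) (_ : Fintype Cset) (X : Cset → SchemeOver ℂ)
        (inj : ∀ c, X c ⟶ (baseChangeHom (e F ι₁)).obj ((C F ι₁ V Φ).X K')),
        (∀ c, IsSmoothProjective 2 (X c)) → Nonempty (IsColimit (Cofan.mk _ inj)) →
          ∃ (𝒥 : ∀ c, Jacobian (X c)) (π : ∀ c, (letI := (e F ι₁).toAlgebra; ((C F ι₁ V Φ).A K').baseChange ℂ) ⟶ (𝒥 c).J),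
            Nonempty (IsLimit (Fan.mk (letI := (e F ι₁).toAlgebra; ((C F ι₁ V Φ).A K').baseChange ℂ) π)) := by
  intro F _ _ Φ ι₁ _ V K' Cset _ X inj hX hcol
  exact exists_jacobian_isLimit_fan_baseChange_of_isProjectiveOver hA (e F ι₁) ((C F ι₁ V Φ).X K')
    ((C F ι₁ V Φ).cpt.projective_X K') ((C F ι₁ V Φ).cpt.smooth_X K') ((C F ι₁ V Φ).alb K') 2 X inj hX hcol

/-- The instance of record (package P2′, HCOMP-TABLE §0): `e F ι₁ := (starRingEnd ℂ).comp ι₁`, all binder types spelled out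
at that literal `e` (the referee's token-by-token test R-4).  HC_CM is NOT proved. [cite: Liu2021, §2.1 Proposition and Lemma 2.2 (1)] -/
theorem hAlb_holds_conj (hA : albanese_baseChange_isLimit_fan_jacobian)
    (P5 : ∀ (F : CMField) (ι₁ : F →+* ℂ) (_ : HermSpace3 F ι₁) (_ : CMType F), PropC5Data (maximalRealSubfield F) F)
    (iso : ∀ (F : CMField) (ι₁ : F →+* ℂ) (_ : HermSpace3 F ι₁) (_ : CMType F), ℕ → Prop)
    (C : ∀ (F : CMField) (ι₁ : F →+* ℂ) (V : HermSpace3 F ι₁) (Φ : CMType F), Sec42Data (P5 F ι₁ V Φ) (iso F ι₁ V Φ)) :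
    ∀ (F : CMField), IsGalois ℚ F → 6 ≤ Module.finrank ℚ F → ∀ (Φ : CMType F) (ι₁ : F →+* ℂ), ι₁ ∈ Φ.1 →
      ∀ (V : HermSpace3 F ι₁) (K' : C5.SmallLevel (C F ι₁ V Φ).S.K₀) (Cset : Type) (_ : Fintype Cset) (X : Cset → SchemeOver ℂ)
        (inj : ∀ c, X c ⟶ (baseChangeHom ((starRingEnd ℂ).comp ι₁)).obj ((C F ι₁ V Φ).X K')),
        (∀ c, IsSmoothProjective 2 (X c)) → Nonempty (IsColimit (Cofan.mk _ inj)) →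
          ∃ (𝒥 : ∀ c, Jacobian (X c))
            (π : ∀ c, (letI := ((starRingEnd ℂ).comp ι₁).toAlgebra; ((C F ι₁ V Φ).A K').baseChange ℂ) ⟶ (𝒥 c).J),
            Nonempty (IsLimit (Fan.mk (letI := ((starRingEnd ℂ).comp ι₁).toAlgebra; ((C F ι₁ V Φ).A K').baseChange ℂ) π)) :=
  hAlb_holds hA (fun _ ι₁ => (starRingEnd ℂ).comp ι₁) P5 iso C

/-- The in-tree instance `e = id` (package P1): the binder `hAlb` of `Model.hComp_of_unif_of_alb`
(`Transposition/Item6PinReachGlue.lean` :183–189, p299801 ✔) VERBATIM.  HC_CM is NOT proved. [cite: Liu2021, §2.1 Proposition and Lemma 2.2 (1)] -/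
theorem hAlb_holds_id (hA : albanese_baseChange_isLimit_fan_jacobian)
    (P5 : ∀ (F : CMField) (ι₁ : F →+* ℂ) (_ : HermSpace3 F ι₁) (_ : CMType F), PropC5Data (maximalRealSubfield F) F)
    (iso : ∀ (F : CMField) (ι₁ : F →+* ℂ) (_ : HermSpace3 F ι₁) (_ : CMType F), ℕ → Prop)
    (C : ∀ (F : CMField) (ι₁ : F →+* ℂ) (V : HermSpace3 F ι₁) (Φ : CMType F), Sec42Data (P5 F ι₁ V Φ) (iso F ι₁ V Φ)) :
    ∀ (F : CMField), IsGalois ℚ F → 6 ≤ Module.finrank ℚ F → ∀ (Φ : CMType F) (ι₁ : F →+* ℂ), ι₁ ∈ Φ.1 →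
      ∀ (V : HermSpace3 F ι₁) (K' : C5.SmallLevel (C F ι₁ V Φ).S.K₀) (Cset : Type) (_ : Fintype Cset) (X : Cset → SchemeOver ℂ)
        (inj : ∀ c, X c ⟶ (baseChangeHom ι₁).obj ((C F ι₁ V Φ).X K')),
        (∀ c, IsSmoothProjective 2 (X c)) → Nonempty (IsColimit (Cofan.mk _ inj)) →
          ∃ (𝒥 : ∀ c, Jacobian (X c)) (π : ∀ c, (letI := ι₁.toAlgebra; ((C F ι₁ V Φ).A K').baseChange ℂ) ⟶ (𝒥 c).J),
            Nonempty (IsLimit (Fan.mk (letI := ι₁.toAlgebra; ((C F ι₁ V Φ).A K').baseChange ℂ) π)) :=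
  hAlb_holds hA (fun _ ι₁ => ι₁) P5 iso C

end Summit.HodgeConjecture.CorCM.Model

end
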